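import Literature.AnabelianGeometry.EtaleTheta.Setting
import Literature.AnabelianGeometry.EtaleTheta.SettingFreeProfinite
import Literature.AnabelianGeometry.SemiGraphs.TemperedCurveBridge
import HarnessLib

/-!
# [EtTh] §1 setting: the bridge from a `ThetaSetting` to the group-level interface
# `OncePuncturedTemperedGroup K` (once-punctured half of the curve-to-group bridge)

Mochizuki, *The étale theta function and its Frobenioid-theoretic manifestations*, Publ. RIMS **45**
(2009), §1, PRIMS PDF pp. 11–13 (printed 237–239) [cite: MochizukiEtTh2009, §1 p.12].

Cell abc-iut, unit W2-L2-03 (merge adapter), L3 ruling η (4): the tree holds [EtTh] §1's tempered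
fundamental group at two levels —
* CURVE level: `EtaleTheta.ThetaSetting p extends SemiGraphs.TemperedCurve p` (seat abc-iut-L2-t1;
  `K ⊆ ℚ̄_p`, `Π^tp_X = PiTemp`, `aug : Π^tp_X → G_{ℚ_p}` of image `G_K`, `toHat : Π^tp_X → Π_X`,
  `augHat`, cusps `Pt/IsCusp/decomp`, and the theta data `toZ : Π^tp_X ↠ Z`, …);
* GROUP level: `SemiGraphs.OncePuncturedTemperedGroup K` (seat abc-iut-L3-t2; bare field `K`,
  `aug : Π → Gal(K̄/K)`, `zQuot`, `PiHat/toHat/augHat`, `deltaHat_free`, `cuspDecomp`), over which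
  `TemperedThetaQuotients`/`TemperedCyclotomic` develop the theta quotients and `Δ_Θ ≅ Ẑ(1)`.
`SemiGraphs/TemperedCurveBridge.lean` (seat abc-iut-L3-t4) passes from `TemperedCurve p` to
`TemperedArithmeticGroup K` given the parameter bundle `GroupLevelData` (Galois identification
`ι : G_K ≃ Gal(K̄/K)`, temperedness, slimness, countability). This file is the ONCE-PUNCTURED half:
`ThetaSetting.toOncePuncturedTemperedGroup D e : OncePuncturedTemperedGroup ↥D.K`, with
`zQuot := toZ`, the completion data of `D`, `augHat := ι ∘ augHat` (its range lies in the closed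
subgroup `G_K` because `Π^tp_X` has dense image in `Π_X` — PROVED, `augHat_mem_GK`), the cusp family
:= all `Π^tp_X`-conjugates of the decomposition groups of cusps, and `deltaHat_free` obtained from the
L2 guard `IsEtThOrigin` through `isFreeProfiniteOnTwo_iff`.

PARAMETERS (`ThetaSetting.OncePuncturedData`, extending `GroupLevelData`; ruling η′: parameters,
never named facts) = what the group-level interface asserts and NEITHER curve-level structure
records — each is a finding reported to the interface owners, not a failure:
(P1) `ker_augHat : Ker(Π_X → G_{ℚ_p}) = Δ_X` (exactness of the completed sequence; `⊇` is proved in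
`SettingCompletion.deltaHat_le_ker_augHat`, `⊆` is not forced by `IsProfiniteCompletion`);
(P2) a cusp exists (type `(1,1)`: "the divisor of cusps", p. 15);
(P3) decomposition groups of cusps lie in `Π^tp_Y = Ker(Π^tp_X ↠ Z)` ("any decomposition group of a
cusp of `Y^log`", p. 13);
(P4) they map ONTO `G_K` (the cusp is `K`-rational; `TemperedCurve` only records an open image);
(P5) the guard `D.IsEtThOrigin` ("`Δ_X` is a profinite free group on 2 generators", p. 12).
Nothing here asserts that such data exist for an actual curve; typed ≠ endorsed; no side is taken on
any disputed claim.
-/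

noncomputable section

namespace Literature.AnabelianGeometry.EtaleTheta

open Literature.AnabelianGeometry.SemiGraphs

namespace ThetaSetting

variable {p : ℕ} [Fact p.Prime] (D : ThetaSetting p)

/-! ### The profinite augmentation lands in `G_K` -/

/-- The profinite augmentation `Π_X → G_{ℚ_p}` of the curve-level interface takes values in the
closed subgroup `G_K`: `Π^tp_X` has dense image in `Π_X` (`IsProfiniteCompletion`), `augHat` is
continuous and extends `aug`, whose image is `G_K` ([EtTh] p. 12: "`1 → Δ_X → Π_X → G_K → 1`").
[cite: MochizukiEtTh2009, §1 p.12] -/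
theorem augHat_mem_GK (g : D.PiHat) : D.augHat g ∈ D.GK := by
  haveI := D.finiteDimensional_K
  have hclosed : IsClosed (D.GK : Set (GQp p)) := D.K.fixingSubgroup_isClosed
  have hdense : g ∈ closure (Set.range D.toHat) := D.isProfiniteCompletion_toHat.denseRange g
  have h1 : D.augHat g ∈ closure (D.augHat '' Set.range D.toHat) :=
    image_closure_subset_closure_image (map_continuous D.augHat) ⟨g, hdense, rfl⟩
  have h2 : D.augHat '' Set.range D.toHat ⊆ (D.GK : Set (GQp p)) := by
    rintro _ ⟨_, ⟨x, rfl⟩, rfl⟩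
    change D.augHat (D.toHat x) ∈ D.K.fixingSubgroup
    rw [D.augHat_comp x, ← D.range_aug]
    exact ⟨x, rfl⟩
  exact hclosed.closure_subset_iff.mpr h2 h1

/-- `Π_X → G_K`, the profinite augmentation with values in `G_K = Fix(K) ≤ G_{ℚ_p}`.
[cite: MochizukiEtTh2009, §1 p.12] -/
def augHatGK : D.PiHat →ₜ* D.GK where
  toMonoidHom := D.augHat.toMonoidHom.codRestrict D.GK D.augHat_mem_GK
  continuous_toFun := (map_continuous D.augHat).subtype_mk _

/-- `augHatGK` followed by the inclusion is `augHat`. [cite: MochizukiEtTh2009, §1 p.12] -/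
@[simp] theorem coe_augHatGK_apply (g : D.PiHat) : ((D.augHatGK g : D.GK) : GQp p) = D.augHat g := rfl

/-- `Π_X → Gal(K̄/K)` through an identification `ι : G_K ≃ Gal(K̄/K)` (the bridge's parameter).
[cite: MochizukiEtTh2009, §1 p.12] -/
def augHatK (ι : D.GK ≃ₜ* Field.absoluteGaloisGroup D.K) :
    D.PiHat →ₜ* Field.absoluteGaloisGroup D.K where
  toMonoidHom := ι.toMulEquiv.toMonoidHom.comp D.augHatGK.toMonoidHom
  continuous_toFun := ι.continuous.comp D.augHatGK.continuous

/-- `augHatK ι` extends `augK ι` along `toHat` (from `augHat ∘ toHat = aug`).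
[cite: MochizukiEtTh2009, §1 p.12] -/
theorem augHatK_toHat (ι : D.GK ≃ₜ* Field.absoluteGaloisGroup D.K) (g : D.PiTemp) :
    D.augHatK ι (D.toHat g) = D.toTemperedCurve.augK ι g := by
  change ι (D.augHatGK (D.toHat g)) = ι (D.toTemperedCurve.augGK g)
  congr 1
  exact Subtype.ext (D.augHat_comp g)

/-- The kernel of `augHatK ι` is the kernel of `augHat` (`ι` is injective).
[cite: MochizukiEtTh2009, §1 p.12] -/
theorem ker_augHatK (ι : D.GK ≃ₜ* Field.absoluteGaloisGroup D.K) :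
    (D.augHatK ι).toMonoidHom.ker = D.augHat.toMonoidHom.ker := by
  ext g
  simp only [MonoidHom.mem_ker]
  change ι (D.augHatGK g) = 1 ↔ D.augHat g = 1
  rw [← map_one ι, ι.apply_eq_iff_eq]
  constructor
  · intro h
    have := congrArg (fun x : D.GK => (x : GQp p)) h
    simpa using this
  · intro h
    exact Subtype.ext (by simpa using h)

/-! ### The cusp family -/

/-- The decomposition groups of the cusps of `Y^log` as a family of subgroups of `Π^tp_X`: all
`Π^tp_X`-conjugates of the representative decomposition groups `D_x`, `x` a cusp ([EtTh] p. 13 "any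
decomposition group of a cusp of `Y^log`"; [SemiAnbd] §6 p. 71). [cite: MochizukiEtTh2009, §1 p.13] -/
def cuspDecompFamily : Set (Subgroup D.PiTemp) :=
  {H | ∃ x : D.Pt, D.IsCusp x ∧ ∃ g : D.PiTemp, H = (D.decomp x).map (MulAut.conj g).toMonoidHom}

/-- A representative decomposition group of a cusp belongs to the family.
[cite: MochizukiEtTh2009, §1 p.13] -/
theorem decomp_mem_cuspDecompFamily {x : D.Pt} (hx : D.IsCusp x) :
    D.decomp x ∈ D.cuspDecompFamily := by
  refine ⟨x, hx, 1, ?_⟩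
  ext h
  simp only [map_one, Subgroup.mem_map, MulEquiv.coe_toMonoidHom, MulAut.one_apply, exists_eq_right]

/-- The family is stable under `Π^tp_X`-conjugation. [cite: MochizukiEtTh2009, §1 p.13] -/
theorem conj_mem_cuspDecompFamily {H : Subgroup D.PiTemp} (hH : H ∈ D.cuspDecompFamily)
    (g : D.PiTemp) : H.map (MulAut.conj g).toMonoidHom ∈ D.cuspDecompFamily := by
  obtain ⟨x, hx, g', rfl⟩ := hH
  refine ⟨x, hx, g * g', ?_⟩
  rw [Subgroup.map_map, map_mul]
  rfl

/-- Members of the family are closed subgroups (conjugation is a homeomorphism).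
[cite: MochizukiEtTh2009, §1 p.13] -/
theorem isClosed_of_mem_cuspDecompFamily {H : Subgroup D.PiTemp} (hH : H ∈ D.cuspDecompFamily) :
    IsClosed (H : Set D.PiTemp) := by
  obtain ⟨x, hx, g, rfl⟩ := hH
  rw [Subgroup.map_equiv_eq_comap_symm', Subgroup.coe_comap]
  refine (D.isClosed_decomp x).preimage ?_
  change Continuous fun h => (MulAut.conj g).symm h
  simp only [MulAut.conj_symm_apply]
  fun_prop

/-- Transport of "free on a `Fin 2`-family" along an equality of subgroups. Private helper.
[folklore] -/
private theorem exists_isFreeProfiniteOn_of_eq {G : Type} [Group G] [TopologicalSpace G]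
    {S T : Subgroup G} (h : S = T) (hT : ∃ x : Fin 2 → T, IsFreeProfiniteOn T x) :
    ∃ x : Fin 2 → S, IsFreeProfiniteOn S x := by
  subst h
  exact hT

/-! ### The parameter bundle and the bridge -/

/-- The PARAMETER bundle of the once-punctured bridge (ruling η′: parameters, never named facts):
t4's `GroupLevelData` (Galois identification `ι : G_K ≃ Gal(K̄/K)`; "`Π`, `Δ` tempered, temp-slim,
Galois-countable") plus what `OncePuncturedTemperedGroup` asserts and the curve-level structures do
not record: (P1) `Ker(Π_X → G_{ℚ_p}) = Δ_X`; (P2) a cusp exists; (P3) decomposition groups of cusps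
lie in `Π^tp_Y = Ker(Π^tp_X ↠ Z)` (p. 13); (P4) they map onto `G_K`; (P5) the guard `IsEtThOrigin`
("`Δ_X` is a profinite free group on 2 generators", p. 12). [cite: MochizukiEtTh2009, §1 p.12] -/
structure OncePuncturedData (D : ThetaSetting p) extends TemperedCurve.GroupLevelData D.toTemperedCurve
    where
  /-- (P1) exactness of `1 → Δ_X → Π_X → G_K`: the kernel of the profinite augmentation is `Δ_X` -/
  ker_augHat : D.augHat.toMonoidHom.ker = D.DeltaHat
  /-- (P2) `X^log` (type `(1,1)`) has a cusp -/
  exists_cusp : ∃ x : D.Pt, D.IsCusp x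
  /-- (P3) decomposition groups of cusps lie in `Π^tp_Y` (p. 13) -/
  decomp_le_ker_toZ : ∀ x : D.Pt, D.IsCusp x → D.decomp x ≤ D.toZ.ker
  /-- (P4) decomposition groups of cusps map onto `G_K` (the cusp is `K`-rational) -/
  map_aug_decomp : ∀ x : D.Pt, D.IsCusp x → (D.decomp x).map D.aug.toMonoidHom = D.GK
  /-- (P5) the vacuity guard of the [EtTh] §1 root -/
  origin : D.IsEtThOrigin

variable {D}

/-- Under the parameters, a member of the cusp family maps onto `Gal(K̄/K)` under `augK ι`.
[cite: MochizukiEtTh2009, §1 p.13] -/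
theorem map_augK_eq_top_of_mem (e : D.OncePuncturedData) {H : Subgroup D.PiTemp}
    (hH : H ∈ D.cuspDecompFamily) :
    H.map (D.toTemperedCurve.augK e.galEquiv).toMonoidHom = ⊤ := by
  obtain ⟨x, hx, g, rfl⟩ := hH
  rw [eq_top_iff]
  intro σ _
  -- write `σ = ι τ` with `τ ∈ G_K`, `τ = aug h`, `h ∈ D_x`; then `σ = augK (g h g⁻¹) · …`
  obtain ⟨τ, rfl⟩ := e.galEquiv.surjective σ
  -- conjugate by `aug g`: `(aug g)⁻¹ τ (aug g) ∈ G_K = aug(D_x)`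
  have hGK : ((((D.toTemperedCurve.augGK g)⁻¹ * τ * D.toTemperedCurve.augGK g : D.GK)) : GQp p) ∈
      (D.decomp x).map D.aug.toMonoidHom := by
    rw [e.map_aug_decomp x hx]
    exact Subtype.mem _
  obtain ⟨h, hh, hhe⟩ := hGK
  refine ⟨g * h * g⁻¹, ⟨h, hh, rfl⟩, ?_⟩
  change e.galEquiv (D.toTemperedCurve.augGK (g * h * g⁻¹)) = e.galEquiv τ
  congr 1
  apply Subtype.ext
  have hhe' : D.aug h = (D.aug g)⁻¹ * (τ : GQp p) * D.aug g := by
    have hhe₁ : D.aug h = (((D.toTemperedCurve.augGK g)⁻¹ * τ * D.toTemperedCurve.augGK g : D.GK) :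
        GQp p) := hhe
    rw [hhe₁, Subgroup.coe_mul, Subgroup.coe_mul, Subgroup.coe_inv,
      TemperedCurve.coe_augGK_apply]
  rw [TemperedCurve.coe_augGK_apply, map_mul, map_mul, map_inv, hhe']
  group

/-- **The once-punctured bridge**: a `ThetaSetting p` together with the parameter bundle `e`
yields the group-level datum `OncePuncturedTemperedGroup ↥D.K` of [EtTh] §1 pp. 11–13 with
`Π := Π^tp_X`, `zQuot := toZ`, the completion `Π_X` of the curve-level interface, `augHat := ι ∘ augHat`,
and the cusp family of `D`. Through it the group-level theory (`TemperedThetaQuotients`,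
`TemperedCyclotomic`, `EtaleTheta/ThetaQuotientFacts`) applies to `D`. [cite: MochizukiEtTh2009, §1 p.12] -/
def toOncePuncturedTemperedGroup (D : ThetaSetting p) (e : D.OncePuncturedData) :
    OncePuncturedTemperedGroup D.K where
  toTemperedArithmeticGroup := D.toTemperedCurve.toTemperedArithmeticGroup e.toGroupLevelData
  zQuot := D.toZ
  zQuot_surjective := D.toZ_surjective
  isOpen_ker_zQuot := D.isOpen_ker_toZ
  PiHat := D.PiHat
  toHat := D.toHat
  isProfiniteCompletion_toHat := D.isProfiniteCompletion_toHat
  toHat_injective := D.toHat_injective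
  augHat := D.augHatK e.galEquiv
  augHat_comp_toHat := D.augHatK_toHat e.galEquiv
  ker_augHat := by
    rw [D.ker_augHatK, e.ker_augHat]
    change D.DeltaHat = ((D.toTemperedCurve.augK e.galEquiv).toMonoidHom.ker.map _).topologicalClosure
    rw [D.toTemperedCurve.ker_augK]
    rfl
  deltaHat_free := by
    have hS : ((D.toTemperedCurve.augK e.galEquiv).toMonoidHom.ker.map D.toHat.toMonoidHom
        ).topologicalClosure = D.DeltaHat := by
      rw [D.toTemperedCurve.ker_augK]; rfl
    exact exists_isFreeProfiniteOn_of_eq hS e.origin.exists_isFreeProfiniteOn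
  cuspDecomp := D.cuspDecompFamily
  cuspDecomp_nonempty := by
    obtain ⟨x, hx⟩ := e.exists_cusp
    exact ⟨D.decomp x, D.decomp_mem_cuspDecompFamily hx⟩
  isClosed_of_mem_cuspDecomp := fun _ hH => D.isClosed_of_mem_cuspDecompFamily hH
  le_ker_of_mem_cuspDecomp := by
    rintro _ ⟨x, hx, g, rfl⟩ y ⟨h, hh, rfl⟩
    exact (MonoidHom.normal_ker D.toZ).conj_mem h (e.decomp_le_ker_toZ x hx hh) g
  conj_mem_cuspDecomp := fun _ hH g => D.conj_mem_cuspDecompFamily hH g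
  map_aug_eq_top_of_mem_cuspDecomp := fun _ hH => map_augK_eq_top_of_mem e hH

/-- The bridge does not change the group: `Π = Π^tp_X`. [cite: MochizukiEtTh2009, §1 p.12] -/
@[simp] theorem toOncePuncturedTemperedGroup_Pi (e : D.OncePuncturedData) :
    (D.toOncePuncturedTemperedGroup e).Pi = D.PiTemp := rfl

/-- The bridge's `Z`-quotient is `toZ`. [cite: MochizukiEtTh2009, §1 p.12] -/
@[simp] theorem toOncePuncturedTemperedGroup_zQuot (e : D.OncePuncturedData) :
    (D.toOncePuncturedTemperedGroup e).zQuot = D.toZ := rfl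

/-- The bridge's `Δ = Ker(aug)` is `Δ^tp_X`. [cite: MochizukiEtTh2009, §1 p.12] -/
theorem toOncePuncturedTemperedGroup_delta (e : D.OncePuncturedData) :
    (D.toOncePuncturedTemperedGroup e).delta = D.DeltaTemp :=
  D.toTemperedCurve.ker_augK e.galEquiv

/-- The bridge's `Δ_X` is the root's `Δ_X = DeltaHat`. [cite: MochizukiEtTh2009, §1 p.12] -/
theorem toOncePuncturedTemperedGroup_deltaHat (e : D.OncePuncturedData) :
    (D.toOncePuncturedTemperedGroup e).deltaHat = D.DeltaHat := by
  change ((D.toOncePuncturedTemperedGroup e).delta.map D.toHat.toMonoidHom).topologicalClosure = _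
  rw [toOncePuncturedTemperedGroup_delta]
  rfl

end ThetaSetting

end Literature.AnabelianGeometry.EtaleTheta

end
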